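import Summits.ResolutionOfSingularities.ResolutionOfSingularities.Theorems.EquisingularLiftEquisingularLiftNatMarkedTwoStep
import Summits.ResolutionOfSingularities.ResolutionOfSingularities.Theorems.EquisingularLiftEquisingularLiftNatDepthModel
import Literature.AlgebraicGeometry.Resolution.BlowupSequences
import HarnessLib

/-!
# [OURS] THE MARKED TOWER STEP AT ALL LEVELS: the origin of `Spec K[y]/(Φ + Ψ)` has blow-up depth `≤ d + 1` in EVERY blow-up tower as soon as, under
# MARKED chart data, every translate `G_a(T + λ)` at a mark on the strict transform has depth `≤ d` at its origin — the recursive engine behind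
# «`A_k`, `D_k`, `E_6`, `E_7`, `E_8` are absolutely isolated» in the depth programme's currency (✓ `towerLevel_succ_of_model`, ✓ `tower_loc`, bricks of
# ✓ …NatMarkedCharts / …NatMarkedTwoStep)
# (cruxes `Theses.EquisingularLift.EquisingularLiftNat` / `…NatThree` / `EquisingularLift`, stmt-ResolutionOfSingularities-20038 / -20148 / -15660)

[OURS · leafhand-res-equisingularlift-12 g0, 2026-08-31; cell `pub/decomp-res`] AI-produced, weaker than expert review; NOT a statement of any manuscript;
nothing here proves resolution of singularities in positive characteristic.  DEF-FREE helper; no `sorry`; standard axioms; ZERO named hypotheses.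

leafhand-10/11 built the depth towers `D` (`hD0`: level `0` = one-step; `hDsucc`: level `d + 1` = «every blow-up at the point is regular over it except at
finitely many closed points of levels `≤ d`»), ✓ `isoHypPoint_of_towerPoints` (finitely many singular points of finite depth ⟹ `IsoHypPoint`) and the
polynomial → scheme bridge for levels `0` (✓ `oneStepAt_origin`) and `1` (✓ `twoStepAt_origin`, marked form ✓ `twoStepAt_origin_marked`).  This file is the bridge
for EVERY level, by recursion on the polynomial side:

* ★★★ `OneStep.towerLevel_succ_origin_marked` — `D` a blow-up tower; `f = Φ + Ψ` (`Φ ≠ 0` a form of degree `μ ≥ 1`, `Ψ ∈ (y)^{μ+1}`) with strict transforms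
  `G_a`, finite mark sets `Λ a ⊆ K^{N+1}` and the MARKED Jacobian datum; and for every mark `λ ∈ Λ a` on the strict transform a splitting of the translate
  `G_a(T + λ) = Φ' + Ψ'` (`Φ'` a form of degree `μ' ≥ 1`, `Ψ' ∈ (T)^{μ'+1}`) whose origin has `D`-LEVEL `≤ d`.  Then the origin `y₀` of `Spec K[y]/(f)` has
  `D`-level `d + 1`.  Proof: ONE MODEL SUFFICES (✓ `towerLevel_succ_of_model`) with the model `blowup.π`; its non-regular points over `y₀` are finitely many
  and sit at marks (✓ `finite_setOf_not_isRegularLocalRing_marked`, ✓ `exists_chart_marked_of_not_isRegularLocalRing`), are closed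
  (✓ `isClosed_singleton_chartOrigin` along `σ̄ ≫ χ`, ✓ `exists_translate_quotientEquiv`), and inherit the level of the translate's origin by LOCALITY of
  tower levels (✓ `tower_loc`) along `Spec (σ̄ ≫ χ)⁻¹` and the chart's open immersion.

Usage (next hands, S each): `A_{2k+1}`/`D_k`/`E_k` vertices get level `k'` by iterating this theorem on the polynomial side (each step = strict transforms +
marks + translates, as in ✓ …NatSecondOrderD4Marked), then ✓ `tower_loc` along the vertex chart and ✓ `isoHypPoint_of_towerPoints`.
Honest label: closes no registered stub.

References: [StacksProject, Tags 0804, 080E]; [GortzWedhorn2020, Prop. 13.91, (13.19)]; through the cited tree files.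
-/

set_option linter.dupNamespace false -- mandated namespace `Summit.<Summit>.<Problem>` of this single-conjunct summit

noncomputable section

open CategoryTheory CategoryTheory.Limits AlgebraicGeometry TopologicalSpace Topology
open MvPolynomial
open Literature.AlgebraicGeometry.Resolution
open AlgebraicGeometry.Scheme.IdealSheafData
open Summit.ResolutionOfSingularities.ResolutionOfSingularities.Cruxes.EquisingularLiftNat.Sections.ND

namespace Summit.ResolutionOfSingularities.ResolutionOfSingularities.Cruxes.EquisingularLiftNat.Sections

namespace OneStep

variable (K : Type) [Field K] {N : ℕ}

set_option maxHeartbeats 1600000 in -- the chart algebra `blowupAlgebra` is a subalgebra of a localisation: slow instance unification (as in …NatAffineTwoStepPackage)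
/-- ★★★ **THE MARKED TOWER STEP AT ALL LEVELS**: marked chart data at the origin of `Spec K[y]/(Φ + Ψ)` with every translate at a mark on the strict transform
of `D`-level `≤ d` at its origin ⟹ the origin has `D`-level `d + 1`, for every blow-up tower `D`. [OURS] [cite: StacksProject, Tag 0804]
[cite: GortzWedhorn2020, Prop. 13.91, (13.19)] -/
theorem towerLevel_succ_origin_marked (D : ℕ → ∀ Γ : Scheme.{0}, Γ → Prop)
    (hD0 : ∀ (Γ : Scheme.{0}) (y : Γ), IsClosed (({y} : Set Γ)) →
      (D 0 Γ y ↔ ∀ (hy : IsClosed (({y} : Set Γ))) (Z : Scheme.{0}) (τ : Z ⟶ Γ), IsBlowup τ (vanishingIdeal ⟨{y}, hy⟩) →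
        ∀ z : Z, τ z = y → IsRegularLocalRing (Z.presheaf.stalk z)))
    (hDsucc : ∀ (d : ℕ) (Γ : Scheme.{0}) (y : Γ), IsClosed (({y} : Set Γ)) →
      (D (d + 1) Γ y ↔ ∀ (hy : IsClosed (({y} : Set Γ))) (Z : Scheme.{0}) (τ : Z ⟶ Γ), IsBlowup τ (vanishingIdeal ⟨{y}, hy⟩) →
        ∃ S' : Finset Z, (∀ z : Z, τ z = y → z ∉ S' → IsRegularLocalRing (Z.presheaf.stalk z)) ∧
          ∀ z ∈ S', τ z = y ∧ IsClosed (({z} : Set Z)) ∧ ∃ d' ≤ d, D d' Z z))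
    (d : ℕ) (Φ Ψ : MvPolynomial (Fin (N + 1)) K) {μ : ℕ} (hμ : 1 ≤ μ)
    (hΦ : Φ.IsHomogeneous μ) (hΦ0 : Φ ≠ 0)
    (hΨ : Ψ ∈ Ideal.span (Set.range (X : Fin (N + 1) → MvPolynomial (Fin (N + 1)) K)) ^ (μ + 1))
    (G : Fin (N + 1) → MvPolynomial (Fin (N + 1)) K)
    (hG : ∀ a, aeval (fun j => X a * Function.update (X : Fin (N + 1) → MvPolynomial (Fin (N + 1)) K) a 1 j) (Φ + Ψ) = X a ^ μ * G a)
    (Λ : Fin (N + 1) → Finset (Fin (N + 1) → K))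
    (hjac : ∀ a, ∀ P : Ideal (MvPolynomial (Fin (N + 1)) K), P.IsPrime → (X a : MvPolynomial (Fin (N + 1)) K) ∈ P → G a ∈ P →
      (∃ j, pderiv j (G a) ∉ P) ∨ ∃ lam ∈ Λ a, ∀ i, (X i - C (lam i) : MvPolynomial (Fin (N + 1)) K) ∈ P)
    (hlev : ∀ a, ∀ lam ∈ Λ a, G a ∈ Ideal.span (Set.range fun i : Fin (N + 1) => (X i - C (lam i) : MvPolynomial (Fin (N + 1)) K)) →
      ∃ (μ' : ℕ) (Φ' Ψ' : MvPolynomial (Fin (N + 1)) K), 1 ≤ μ' ∧ Φ'.IsHomogeneous μ' ∧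
        Ψ' ∈ Ideal.span (Set.range (X : Fin (N + 1) → MvPolynomial (Fin (N + 1)) K)) ^ (μ' + 1) ∧
        aeval (fun i => X i + C (lam i)) (G a) = Φ' + Ψ' ∧
        ∀ y' : Spec (CommRingCat.of (MvPolynomial (Fin (N + 1)) K ⧸ Ideal.span {Φ' + Ψ'})),
          y'.asIdeal = Ideal.map (Ideal.Quotient.mk (Ideal.span {Φ' + Ψ'}))
            (Ideal.span (Set.range (X : Fin (N + 1) → MvPolynomial (Fin (N + 1)) K))) →
          ∃ d' ≤ d, D d' (Spec (CommRingCat.of (MvPolynomial (Fin (N + 1)) K ⧸ Ideal.span {Φ' + Ψ'}))) y')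
    (y₀ : Spec (CommRingCat.of (MvPolynomial (Fin (N + 1)) K ⧸ Ideal.span {Φ + Ψ})))
    (hy₀ : y₀.asIdeal = Ideal.map (Ideal.Quotient.mk (Ideal.span {Φ + Ψ}))
      (Ideal.span (Set.range (X : Fin (N + 1) → MvPolynomial (Fin (N + 1)) K)))) :
    D (d + 1) (Spec (CommRingCat.of (MvPolynomial (Fin (N + 1)) K ⧸ Ideal.span {Φ + Ψ}))) y₀ := by
  classical
  -- the origin is a closed point
  have hmax := isMaximal_map_mk_span_range_X K Φ Ψ hμ hΦ hΨ
  have hy : IsClosed ({y₀} : Set (Spec (CommRingCat.of (MvPolynomial (Fin (N + 1)) K ⧸ Ideal.span {Φ + Ψ})))) :=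
    (PrimeSpectrum.isClosed_singleton_iff_isMaximal y₀).mpr (hy₀ ▸ hmax)
  -- ONE MODEL: the blow-up `blowup.π`
  let τ₀ := blowup.π (vanishingIdeal (⟨{y₀}, hy⟩ : Closeds (Spec (CommRingCat.of (MvPolynomial (Fin (N + 1)) K ⧸ Ideal.span {Φ + Ψ})))))
  have hτ₀ : IsBlowup τ₀ (vanishingIdeal ⟨{y₀}, hy⟩) := blowup.isBlowup _
  haveI : IsProper τ₀ := hτ₀.isProper
  -- the marks as maximal ideals
  let M : Fin (N + 1) → Finset (Ideal (MvPolynomial (Fin (N + 1)) K)) := fun a =>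
    (Λ a).image (fun lam => Ideal.span (Set.range fun i : Fin (N + 1) => (X i - C (lam i) : MvPolynomial (Fin (N + 1)) K)))
  have hM : ∀ a, ∀ 𝔪 ∈ M a, 𝔪.IsMaximal := by
    intro a 𝔪 h𝔪
    obtain ⟨lam, -, rfl⟩ := Finset.mem_image.mp h𝔪
    exact isMaximal_span_range_X_sub_C K lam
  have hjacM : ∀ a, ∀ P : Ideal (MvPolynomial (Fin (N + 1)) K), P.IsPrime → (X a : MvPolynomial (Fin (N + 1)) K) ∈ P → G a ∈ P →
      (∃ j, pderiv j (G a) ∉ P) ∨ ∃ 𝔪 ∈ M a, 𝔪 ≤ P := by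
    intro a P hP haP hGP
    rcases hjac a P hP haP hGP with h | ⟨lam, hlam, hP'⟩
    · exact Or.inl h
    · exact Or.inr ⟨_, Finset.mem_image.mpr ⟨lam, hlam, rfl⟩, Ideal.span_le.mpr (Set.range_subset_iff.mpr fun i => hP' i)⟩
  -- the dictionary `vanishingIdeal {y₀} = ofIdealTop (ȳ)`
  have hrad : (Ideal.map (Ideal.Quotient.mk (Ideal.span {Φ + Ψ}))
      (Ideal.span (Set.range (X : Fin (N + 1) → MvPolynomial (Fin (N + 1)) K)))).IsRadical := hmax.isPrime.isRadical
  have hsing : ({y₀} : Set (Spec (CommRingCat.of (MvPolynomial (Fin (N + 1)) K ⧸ Ideal.span {Φ + Ψ})))) =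
      PrimeSpectrum.zeroLocus ((Ideal.map (Ideal.Quotient.mk (Ideal.span {Φ + Ψ}))
        (Ideal.span (Set.range (X : Fin (N + 1) → MvPolynomial (Fin (N + 1)) K))) : Set _)) := by
    rw [← hy₀]
    exact singleton_eq_zeroLocus_of_isMaximal y₀ (hy₀ ▸ hmax)
  have hC : (⟨{y₀}, hy⟩ : Closeds (Spec (CommRingCat.of (MvPolynomial (Fin (N + 1)) K ⧸ Ideal.span {Φ + Ψ})))) =
      ⟨PrimeSpectrum.zeroLocus ((Ideal.map (Ideal.Quotient.mk (Ideal.span {Φ + Ψ}))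
        (Ideal.span (Set.range (X : Fin (N + 1) → MvPolynomial (Fin (N + 1)) K))) : Set _)), PrimeSpectrum.isClosed_zeroLocus _⟩ :=
    Closeds.ext hsing
  have hV : vanishingIdeal (⟨{y₀}, hy⟩ : Closeds (Spec (CommRingCat.of (MvPolynomial (Fin (N + 1)) K ⧸ Ideal.span {Φ + Ψ})))) = (ofIdealTop (Ideal.map (Scheme.ΓSpecIso (CommRingCat.of (MvPolynomial (Fin (N + 1)) K ⧸ Ideal.span {Φ + Ψ}))).inv.hom (Ideal.map (Ideal.Quotient.mk (Ideal.span {Φ + Ψ})) (Ideal.span (Set.range (X : Fin (N + 1) → MvPolynomial (Fin (N + 1)) K)))))) := by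
    rw [hC]
    exact vanishingIdeal_zeroLocus_eq_ofIdealTop_of_isRadical _ hrad
  have hsupp : ∀ z, τ₀ z = y₀ ↔ τ₀ z ∈ ((ofIdealTop (Ideal.map (Scheme.ΓSpecIso (CommRingCat.of (MvPolynomial (Fin (N + 1)) K ⧸ Ideal.span {Φ + Ψ}))).inv.hom (Ideal.map (Ideal.Quotient.mk (Ideal.span {Φ + Ψ})) (Ideal.span (Set.range (X : Fin (N + 1) → MvPolynomial (Fin (N + 1)) K)))))).support : Set (Spec (CommRingCat.of (MvPolynomial (Fin (N + 1)) K ⧸ Ideal.span {Φ + Ψ})))) := by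
    intro z
    rw [← hV, Scheme.IdealSheafData.coe_support_vanishingIdeal]
    exact Iff.rfl
  have hτ₀' : IsBlowup τ₀ (ofIdealTop (Ideal.map (Scheme.ΓSpecIso (CommRingCat.of (MvPolynomial (Fin (N + 1)) K ⧸ Ideal.span {Φ + Ψ}))).inv.hom (Ideal.map (Ideal.Quotient.mk (Ideal.span {Φ + Ψ})) (Ideal.span (Set.range (X : Fin (N + 1) → MvPolynomial (Fin (N + 1)) K)))))) := by
    rw [← hV]; exact hτ₀
  -- locality of the payload «some level `≤ d`»
  have hloc := tower_loc D hD0 hDsucc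
  -- the finite set of non-regular points of the model over the origin
  obtain ⟨S₀, hS₀⟩ := (finite_setOf_not_isRegularLocalRing_marked K Φ Ψ hΦ hΦ0 hΨ G hG M hM hjacM hτ₀').exists_finset_coe
  refine towerLevel_succ_of_model D hD0 hDsucc d hy _ τ₀ hτ₀ S₀ (fun z hz hzS => ?_) (fun z hzS => ?_)
  · by_contra hreg
    apply hzS
    rw [← Finset.mem_coe, hS₀]
    exact ⟨(hsupp z).mp hz, hreg⟩
  · have hzS' : z ∈ (S₀ : Set _) := Finset.mem_coe.mpr hzS
    rw [hS₀] at hzS'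
    obtain ⟨hzs, hzreg⟩ := hzS'
    obtain ⟨a, χ, φ, hφ, 𝔪, w, h𝔪M, hχa, hφρ, hw, hφw⟩ :=
      exists_chart_marked_of_not_isRegularLocalRing K Φ Ψ hΦ hΦ0 hΨ G hG M hM hjacM hτ₀' z hzs hzreg
    obtain ⟨lam, hlam, h𝔪eq⟩ := Finset.mem_image.mp h𝔪M
    have hGa : G a ∈ Ideal.span (Set.range fun i : Fin (N + 1) => (X i - C (lam i) : MvPolynomial (Fin (N + 1)) K)) := by
      rw [h𝔪eq]
      exact mem_of_mark_ne_top K (G a) 𝔪 (hM a 𝔪 h𝔪M) χ w.asIdeal w.isPrime.ne_top hw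
    obtain ⟨μ', Φ', Ψ', hμ', hΦ', hΨ', hGeq, hlev'⟩ := hlev a lam hlam hGa
    rw [← h𝔪eq] at hw
    -- the composite chart isomorphism `K[T]/(Φ' + Ψ') ≅ K[T]/(G a) ≅ chart ring`
    obtain ⟨σ, hσ⟩ := exists_translate_quotientEquiv K lam (G a) (Φ' + Ψ') hGeq
    have hw' : w.asIdeal = Ideal.map (σ.trans χ).toRingHom (Ideal.map (Ideal.Quotient.mk (Ideal.span {Φ' + Ψ'}))
        (Ideal.span (Set.range (X : Fin (N + 1) → MvPolynomial (Fin (N + 1)) K)))) := by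
      rw [hw, ← hσ, Ideal.map_map]
      rfl
    obtain ⟨hwcl, hzcl⟩ := isClosed_singleton_chartOrigin K Φ Ψ a (Φ' + Ψ') (σ.trans χ) τ₀ φ w hw'
    refine ⟨(hsupp z).mpr hzs, by rw [← hφw]; exact hzcl, ?_⟩
    -- the payload at the origin of `Spec K[T]/(Φ' + Ψ')`
    have hmax' := isMaximal_map_mk_span_range_X K Φ' Ψ' hμ' hΦ' hΨ'
    let y₀' : Spec (CommRingCat.of (MvPolynomial (Fin (N + 1)) K ⧸ Ideal.span {Φ' + Ψ'})) :=
      ⟨Ideal.map (Ideal.Quotient.mk (Ideal.span {Φ' + Ψ'})) (Ideal.span (Set.range (X : Fin (N + 1) → MvPolynomial (Fin (N + 1)) K))),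
        hmax'.isPrime⟩
    have hy₀' : y₀'.asIdeal = Ideal.map (Ideal.Quotient.mk (Ideal.span {Φ' + Ψ'}))
        (Ideal.span (Set.range (X : Fin (N + 1) → MvPolynomial (Fin (N + 1)) K))) := rfl
    have hy₀'cl : IsClosed ({y₀'} : Set _) := (PrimeSpectrum.isClosed_singleton_iff_isMaximal y₀').mpr hmax'
    obtain ⟨d', hd', hD'⟩ := hlev' y₀' hy₀'
    refine ⟨d', hd', ?_⟩
    -- transport along `Spec (σ ≫ χ)⁻¹ : Spec K[T]/(Φ' + Ψ') ≅ Spec (chart ring)`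
    let e₁ : Spec (CommRingCat.of (MvPolynomial (Fin (N + 1)) K ⧸ Ideal.span {Φ' + Ψ'})) ≅ Spec (CommRingCat.of (blowupAlgebra ((Ideal.span (Set.range (X : Fin (N + 1) → MvPolynomial (Fin (N + 1)) K))).map
          (Ideal.Quotient.mk (Ideal.span {Φ + Ψ}))) (Ideal.Quotient.mk (Ideal.span {Φ + Ψ}) (X a)))) :=
      Scheme.Spec.mapIso ((σ.trans χ).symm.toCommRingCatIso).op
    have he₁ : e₁.hom y₀' = w := by
      apply PrimeSpectrum.ext
      rw [hw']
      change Ideal.comap (σ.trans χ).symm.toRingHom y₀'.asIdeal = _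
      rw [hy₀']
      exact Ideal.comap_symm (σ.trans χ)
    have he₁' : e₁.inv w = y₀' := by
      rw [← he₁]
      change (e₁.hom ≫ e₁.inv) y₀' = y₀'
      rw [e₁.hom_inv_id]
      rfl
    haveI : IsIso (e₁.inv ∣_ (⊤ : (Spec (CommRingCat.of (MvPolynomial (Fin (N + 1)) K ⧸ Ideal.span {Φ' + Ψ'}))).Opens)) := inferInstance
    have hDw : D d' (Spec (CommRingCat.of (blowupAlgebra ((Ideal.span (Set.range (X : Fin (N + 1) → MvPolynomial (Fin (N + 1)) K))).map
          (Ideal.Quotient.mk (Ideal.span {Φ + Ψ}))) (Ideal.Quotient.mk (Ideal.span {Φ + Ψ}) (X a))))) w :=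
      (hloc d' _ _ e₁.inv ⊤ inferInstance y₀' (Set.mem_univ _) hy₀'cl w he₁' hwcl).mp hD'
    -- transport along the open immersion `φ = e₂.hom ≫ U.ι`
    haveI := hφ
    let U : (blowup (vanishingIdeal (⟨{y₀}, hy⟩ : Closeds (Spec (CommRingCat.of (MvPolynomial (Fin (N + 1)) K ⧸ Ideal.span {Φ + Ψ})))))).Opens :=
      φ.opensRange
    let e₂ := φ.isoOpensRange
    have hφU : ∀ v, U.ι (e₂.hom v) = φ v := fun v => by
      rw [← Scheme.Hom.comp_apply, Scheme.Hom.isoOpensRange_hom_ι]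
    have hzU : φ w ∈ U := ⟨w, rfl⟩
    have hu₀cl : IsClosed ({e₂.hom w} : Set (U : Scheme.{0})) :=
      PointChain.isClosed_singleton_of_injective U.ι U.ι.isOpenEmbedding.injective (by rw [hφU]; exact hzcl)
    have he₂' : e₂.inv (e₂.hom w) = w := by
      change (e₂.hom ≫ e₂.inv) w = w
      rw [e₂.hom_inv_id]
      rfl
    haveI : IsIso (e₂.inv ∣_ (⊤ : (Spec (CommRingCat.of (blowupAlgebra ((Ideal.span (Set.range (X : Fin (N + 1) → MvPolynomial (Fin (N + 1)) K))).map
          (Ideal.Quotient.mk (Ideal.span {Φ + Ψ}))) (Ideal.Quotient.mk (Ideal.span {Φ + Ψ}) (X a))))).Opens)) := inferInstance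
    have hDu : D d' (U : Scheme.{0}) (e₂.hom w) :=
      (hloc d' _ _ e₂.inv ⊤ inferInstance w (Set.mem_univ _) hwcl (e₂.hom w) he₂' hu₀cl).mp hDw
    haveI := PointChain.isIso_ι_morphismRestrict_self U
    rw [← hφw]
    exact (hloc d' _ _ U.ι U inferInstance (φ w) hzU hzcl (e₂.hom w) (hφU w) hu₀cl).mpr hDu

end OneStep

end Summit.ResolutionOfSingularities.ResolutionOfSingularities.Cruxes.EquisingularLiftNat.Sections

end
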